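import Mathlib
import Summits.Ventures.DiscreteObjects.Mahler.CyclotomicIntegerLehmer
import Summits.Ventures.DiscreteObjects.Mahler.SchinzelTotallyPositive

/-!
# Schinzel's bound for cyclotomic integers: `φ^{φ(m)} ≤ (∏_μ max(1,|g(μ)|))²` (venture `DiscreteObjects`, target L)

Cell `pub-namedobj`, seat `pub-namedobj-mahler-g28`. Framing: lottery ticket; floor = certified bounds/negative ranges.

A. Schinzel, *On the product of the conjugates outside the unit circle of an algebraic number*, Acta Arith. 24 (1973),
the CM-field case, for the cyclotomic integers `α = g(ζ_m)`, by the one-line proof of Höhn–Skoruppa already in the tree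
(`SchinzelTotallyPositive.goldenRatio_mul_rpow_le_max`: `φ · x^a |x-1|^b ≤ max(1,x)`, [McKee–Smyth Ex. 14.11]):
**for `m ≥ 1`, `ζ` a primitive `m`-th root of unity and `g ∈ ℤ[X]` with `g(ζ) ≠ 0` not a root of unity,
`φ^{φ(m)} ≤ (∏_μ max(1,|g(μ)|))²`** over the primitive `m`-th roots of unity, `φ = (1+√5)/2`
(`goldenRatio_pow_totient_le_prod_sq`).  The numbers `x_μ = |g(μ)|² = g(μ)g(μ^{m-1})` are positive reals whose product
and whose product of `x_μ - 1` are nonzero rational integers (`one_le_norm_prod_aeval_primitiveRoots`); `x_μ ≠ 1` since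
one conjugate of modulus `1` forces all (conjugation of `g(X)g(X^{m-1}) - 1`) and then Kronecker's theorem (Mathlib's
`Polynomial.pow_eq_one_of_mahlerMeasure_eq_one`) makes `g(ζ)` a root of unity.  In Mahler-measure form this is
`M(α)² ≥ φ^{deg α}`, `h(α) ≥ ½ log φ = 0.2406…` (file `CyclotomicIntegerSchinzelMeasure`), sharper for INTEGERS than
[cite: BombieriGubler2001, Theorem 4.4.9] (`log(5/2)/10`, all `α ∈ ℚ(ζ_m)`) and sharp at `α = φ = 1 + ζ₅ + ζ₅⁴`.
REPLICATION of a classical theorem; no new mathematics claimed.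
-/

namespace Summit.Ventures.DiscreteObjects.Mahler

open Polynomial Finset

/-- The product of an integer-coefficient "norm form" `∏_μ h(μ)` over the primitive `m`-th roots of unity is an
integer; if no factor vanishes, its modulus is `≥ 1`. -/
theorem one_le_norm_prod_aeval_primitiveRoots {m : ℕ} (hm : 0 < m) (h : ℤ[X])
    (hne : ∀ μ ∈ primitiveRoots m ℂ, aeval μ h ≠ 0) : 1 ≤ ‖∏ μ ∈ primitiveRoots m ℂ, aeval μ h‖ := by
  classical
  set Fc : ℂ[X] := ∏ μ ∈ primitiveRoots m ℂ, (X - C (aeval μ h)) with hFc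
  have hFcmon : Fc.Monic := monic_prod_of_monic _ _ (fun _ _ => monic_X_sub_C _)
  obtain ⟨F, hFmap, -, -⟩ := lifts_and_natDegree_eq_and_monic (prod_X_sub_C_aeval_primitiveRoots_lifts hm h) hFcmon
  -- `F(0) = ∏ (-h(μ))`
  have hev : ((F.eval 0 : ℤ) : ℂ) = ∏ μ ∈ primitiveRoots m ℂ, (0 - aeval μ h) := by
    have h1 : (F.map (Int.castRingHom ℂ)).eval 0 = ((F.eval 0 : ℤ) : ℂ) := by
      rw [eval_map, eval₂_at_zero, eq_intCast, coeff_zero_eq_eval_zero]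
    rw [← h1, hFmap, eval_prod]
    refine Finset.prod_congr rfl fun μ _ => ?_
    rw [eval_sub, eval_X, eval_C]
  have hne0 : F.eval 0 ≠ 0 := by
    intro h0
    have h1 := hev
    rw [h0, Int.cast_zero] at h1
    exact (Finset.prod_ne_zero_iff.2 fun μ hμ => sub_ne_zero.2 (hne μ hμ).symm) (by rw [← h1])
  have hnorm : ‖∏ μ ∈ primitiveRoots m ℂ, aeval μ h‖ = ‖((F.eval 0 : ℤ) : ℂ)‖ := by
    rw [hev, norm_prod, norm_prod]
    refine Finset.prod_congr rfl fun μ _ => ?_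
    rw [zero_sub, norm_neg]
  rw [hnorm, Complex.norm_intCast]
  exact_mod_cast Int.one_le_abs hne0

/-- For a primitive `m`-th root of unity `μ` and `g ∈ ℤ[X]`: `g(μ^{m-1}) = conj(g(μ))`, so
`g(μ) · g(μ^{m-1}) = |g(μ)|²`. -/
theorem aeval_mul_aeval_pow_sub_one {m : ℕ} (hm : 0 < m) (g : ℤ[X]) {μ : ℂ} (hμ : IsPrimitiveRoot μ m) :
    aeval μ g * aeval (μ ^ (m - 1)) g = ((‖aeval μ g‖ ^ 2 : ℝ) : ℂ) := by
  have hconj : (starRingEnd ℂ) μ = μ ^ (m - 1) := by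
    have h1 : μ * (starRingEnd ℂ) μ = 1 := by
      rw [Complex.mul_conj, Complex.normSq_eq_norm_sq, hμ.norm'_eq_one hm.ne']; norm_num
    have h2 : μ * μ ^ (m - 1) = 1 := by rw [← pow_succ', Nat.sub_add_cancel hm, hμ.pow_eq_one]
    have hμ0 : μ ≠ 0 := hμ.ne_zero hm.ne'
    exact mul_left_cancel₀ hμ0 (h1.trans h2.symm)
  have haeval : aeval (μ ^ (m - 1)) g = (starRingEnd ℂ) (aeval μ g) := by
    rw [← hconj, aeval_def, aeval_def, hom_eval₂]
    congr 1
    exact Subsingleton.elim _ _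
  rw [haeval, Complex.mul_conj, Complex.normSq_eq_norm_sq]

/-- `(max 1 t)² = max 1 (t²)` for `t ≥ 0`. -/
theorem max_one_sq_eq {t : ℝ} (ht : 0 ≤ t) : (max 1 t) ^ 2 = max 1 (t ^ 2) := by
  rcases le_total t 1 with h | h
  · rw [max_eq_left h, max_eq_left (by nlinarith), one_pow]
  · rw [max_eq_right h, max_eq_right (by nlinarith)]

/-- **Schinzel's theorem for cyclotomic integers, product form.**  For `m ≥ 1`, a primitive `m`-th root of unity `ζ`,
and `g ∈ ℤ[X]` with `α = g(ζ) ≠ 0` not a root of unity: `φ^{φ(m)} ≤ (∏_μ max(1,|g(μ)|))²`, `φ = (1+√5)/2`, the product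
over the primitive `m`-th roots of unity.  Proof (Schinzel 1973 for CM fields, via Höhn–Skoruppa): the numbers
`x_μ = |g(μ)|² = g(μ) g(μ^{-1})` are positive reals with `∏ x_μ` and `∏ (x_μ - 1)` nonzero integers — `x_μ ≠ 1` because
`|g(μ₀)| = 1` for one `μ₀` forces it for all (conjugation of `g(X)g(X^{m-1}) - 1`) and then Kronecker's theorem makes
`α` a root of unity — and the inequality `φ · x^a |x-1|^b ≤ max(1,x)` (`goldenRatio_mul_rpow_le_max`) multiplies up. -/
theorem goldenRatio_pow_totient_le_prod_sq {m : ℕ} (hm : 0 < m) (g : ℤ[X]) {ζ : ℂ} (hζ : IsPrimitiveRoot ζ m)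
    (h0 : aeval ζ g ≠ 0) (hnu : ∀ k : ℕ, 0 < k → aeval ζ g ^ k ≠ 1) :
    Real.goldenRatio ^ m.totient ≤ (∏ μ ∈ primitiveRoots m ℂ, max 1 ‖aeval μ g‖) ^ 2 := by
  classical
  set S := primitiveRoots m ℂ with hS
  have hcard : S.card = m.totient := (Complex.isPrimitiveRoot_exp m hm.ne').card_primitiveRoots
  -- (1) no conjugate vanishes
  have hne : ∀ μ ∈ S, aeval μ g ≠ 0 := by
    intro μ hμ hμ0
    exact h0 (aeval_eq_zero_of_primitiveRoot hm ((mem_primitiveRoots hm).1 hμ) hμ0 hζ)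
  -- (2) the polynomial `b = g · g(X^{m-1})` with `b(μ) = |g(μ)|²`
  set b : ℤ[X] := g * expand ℤ (m - 1) g with hb
  have hbμ : ∀ μ ∈ S, aeval μ b = ((‖aeval μ g‖ ^ 2 : ℝ) : ℂ) := by
    intro μ hμ
    rw [hb, map_mul, expand_aeval, aeval_mul_aeval_pow_sub_one hm g ((mem_primitiveRoots hm).1 hμ)]
  -- (3) no conjugate has modulus `1` (Kronecker)
  have hne1 : ∀ μ ∈ S, ‖aeval μ g‖ ^ 2 ≠ 1 := by
    intro μ₀ hμ₀ h1
    have hμ₀' := (mem_primitiveRoots hm).1 hμ₀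
    -- `b - 1` vanishes at `μ₀`, hence at every primitive root
    have hQ : aeval μ₀ (b - 1) = 0 := by rw [map_sub, hbμ μ₀ hμ₀, h1, map_one]; push_cast; ring
    have hall : ∀ μ ∈ S, ‖aeval μ g‖ = 1 := by
      intro μ hμ
      have h := aeval_eq_zero_of_primitiveRoot hm hμ₀' hQ ((mem_primitiveRoots hm).1 hμ)
      rw [map_sub, hbμ μ hμ, map_one, sub_eq_zero] at h
      have h2 : ‖aeval μ g‖ ^ 2 = 1 := by exact_mod_cast h
      nlinarith [norm_nonneg (aeval μ g)]
    -- the integer polynomial `F = ∏ (X - g(μ))` has Mahler measure `1`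
    set Fc : ℂ[X] := ∏ μ ∈ S, (X - C (aeval μ g)) with hFc
    have hFcmon : Fc.Monic := monic_prod_of_monic _ _ (fun _ _ => monic_X_sub_C _)
    obtain ⟨F, hFmap, -, -⟩ :=
      lifts_and_natDegree_eq_and_monic (prod_X_sub_C_aeval_primitiveRoots_lifts hm g) hFcmon
    have hMF : (F.map (Int.castRingHom ℂ)).mahlerMeasure = 1 := by
      rw [hFmap, mahlerMeasure_prod_X_sub_C]
      exact Finset.prod_eq_one fun μ hμ => by rw [hall μ hμ, max_self]
    have hroot : aeval ζ g ∈ F.aroots ℂ := by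
      rw [aroots_def, algebraMap_int_eq, hFmap]
      have hmm : ((primitiveRoots m ℂ).val.map fun μ => X - C (aeval μ g)) =
          (((primitiveRoots m ℂ).val.map fun μ => aeval μ g).map fun a : ℂ => X - C a) := by
        rw [Multiset.map_map]; rfl
      rw [Finset.prod_eq_multiset_prod, hmm, roots_multiset_prod_X_sub_C, Multiset.mem_map]
      exact ⟨ζ, (mem_primitiveRoots hm).2 hζ, rfl⟩
    obtain ⟨n, hn, hn1⟩ := Polynomial.pow_eq_one_of_mahlerMeasure_eq_one hMF h0 hroot
    exact hnu n hn hn1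
  -- (4) the pointwise inequality
  set a : ℝ := (1 - 1 / √5) / 2 with ha
  set c : ℝ := 1 / √5 with hc
  have hs0 : (0 : ℝ) < √5 := Real.sqrt_pos.mpr (by norm_num)
  have hs1 : (1 : ℝ) < √5 := by
    have hs2 : (√5 : ℝ) ^ 2 = 5 := Real.sq_sqrt (by norm_num); nlinarith
  have ha0 : 0 ≤ a := by
    rw [ha]; have : 1 / √5 < 1 := (div_lt_one hs0).mpr hs1; linarith
  have hc0 : 0 ≤ c := by rw [hc]; positivity
  set x : ℂ → ℝ := fun μ => ‖aeval μ g‖ ^ 2 with hx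
  have hxpos : ∀ μ ∈ S, 0 < x μ := fun μ hμ => by
    rw [hx]; exact pow_pos (norm_pos_iff.2 (hne μ hμ)) 2
  have hpt : ∀ μ ∈ S, Real.goldenRatio * (x μ ^ a * |x μ - 1| ^ c) ≤ (max 1 ‖aeval μ g‖) ^ 2 := by
    intro μ hμ
    rw [max_one_sq_eq (norm_nonneg _)]
    exact goldenRatio_mul_rpow_le_max (hxpos μ hμ) (hne1 μ hμ)
  -- (5) multiply
  have hprodle : ∏ μ ∈ S, Real.goldenRatio * (x μ ^ a * |x μ - 1| ^ c) ≤ ∏ μ ∈ S, (max 1 ‖aeval μ g‖) ^ 2 :=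
    Finset.prod_le_prod (fun μ _ => by positivity) hpt
  rw [Finset.prod_mul_distrib, Finset.prod_mul_distrib, Finset.prod_const, hcard, Finset.prod_pow,
    Real.finsetProd_rpow S x (fun μ hμ => (hxpos μ hμ).le) a,
    Real.finsetProd_rpow S (fun μ => |x μ - 1|) (fun μ _ => abs_nonneg _) c] at hprodle
  -- (6) `∏ x_μ ≥ 1` and `∏ |x_μ - 1| ≥ 1`
  have hX1 : 1 ≤ ∏ μ ∈ S, x μ := by
    have h := one_le_norm_prod_aeval_primitiveRoots hm g hne
    rw [norm_prod] at h
    have h2 : ∏ μ ∈ S, x μ = (∏ μ ∈ S, ‖aeval μ g‖) ^ 2 := by rw [hx, Finset.prod_pow]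
    rw [h2]
    nlinarith
  have hY1 : 1 ≤ ∏ μ ∈ S, |x μ - 1| := by
    have hne' : ∀ μ ∈ S, aeval μ (b - 1) ≠ 0 := by
      intro μ hμ hz
      rw [map_sub, hbμ μ hμ, map_one, sub_eq_zero] at hz
      exact hne1 μ hμ (by exact_mod_cast hz)
    have h := one_le_norm_prod_aeval_primitiveRoots hm (b - 1) hne'
    rw [norm_prod] at h
    have h2 : ∏ μ ∈ S, |x μ - 1| = ∏ μ ∈ S, ‖aeval μ (b - 1)‖ := by
      refine Finset.prod_congr rfl fun μ hμ => ?_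
      rw [map_sub, hbμ μ hμ, map_one, ← Complex.ofReal_one, ← Complex.ofReal_sub, Complex.norm_real,
        Real.norm_eq_abs]
    rw [h2]; exact h
  have hlow : 1 ≤ (∏ μ ∈ S, x μ) ^ a * (∏ μ ∈ S, |x μ - 1|) ^ c := by
    have h1 : 1 ≤ (∏ μ ∈ S, x μ) ^ a := Real.one_le_rpow hX1 ha0
    have h2 : 1 ≤ (∏ μ ∈ S, |x μ - 1|) ^ c := Real.one_le_rpow hY1 hc0
    nlinarith
  have hφ0 : 0 < Real.goldenRatio ^ m.totient := pow_pos Real.goldenRatio_pos _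
  calc Real.goldenRatio ^ m.totient = Real.goldenRatio ^ m.totient * 1 := (mul_one _).symm
    _ ≤ Real.goldenRatio ^ m.totient * ((∏ μ ∈ S, x μ) ^ a * (∏ μ ∈ S, |x μ - 1|) ^ c) :=
        mul_le_mul_of_nonneg_left hlow hφ0.le
    _ ≤ (∏ μ ∈ S, max 1 ‖aeval μ g‖) ^ 2 := hprodle

end Summit.Ventures.DiscreteObjects.Mahler
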